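import Literature.Probability.RandomPlanarGeometry.WholePlaneLoewnerMarkov
import HarnessLib

/-!
# Whole-plane Loewner chains generated by curves: from the radial pieces to `IsCurve`

Topic `Probability/RandomPlanarGeometry`; theorems only, sequel of `WholePlaneLoewnerMarkov` and
`WholePlaneSLEProofs`. This is the deterministic part of the proof of Miller–Sheffield (2013),
Prop. 2.5 (whole-plane SLE_κ(ρ) is generated by a continuous curve) in the boundary-avoiding
regime (first paragraph of the printed proof, arXiv p. 18): "Fix `T ∈ ℝ`. … we can express
`Kₜ|_{[T,∞)}` as the conformal image of a radial SLE_κ^μ(ρ) process … generated by a continuous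
curve which … is almost surely non-boundary intersecting … This implies that `Kₜ|_{[T,∞)}` is
generated by the conformal image of a continuous non-boundary-intersecting curve … More precisely,
`Kₜ|_{[T,∞)}` is the complement of the unbounded connected component of
`ℂ ∖ ((1/g_T⁻¹)(η([T,t])) ∪ K_T)` … The result follows since `S` can be taken arbitrarily small."

For a whole-plane Loewner chain `C` with continuous driving angle `lam` (`WholePlaneLoewnerChain`,
Lawler (2005), Prop. 4.21), a base time `b`, and a continuous two-sided path `γ`, write
`Ψ_b z = 1/g_b(z)` for the interior coordinate of `WholePlaneLoewnerMarkov` (a homeomorphism of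
`ℂ ∖ K_b` onto the punctured disc, inverse `w ↦ F_b(1/w)`), so that `η = Ψ_b ∘ γ` on `(b, ∞)` is the
candidate radial curve in `𝔻` after time `b`:

* `compl_hull_eq_unboundedComponent_of_disc` — **radial generation ⇒ exterior (Markovian)
  generation**: if `γ(s) ∉ K_b` for `s ∈ (b, t]` (the radial piece stays inside `𝔻`) and the radial
  Loewner domain at time `t - b` of the shifted driver is the component of `0` in
  `𝔻 ∖ η((b, t])`, then `ℂ ∖ Kₜ` is the unbounded component of `ℂ ∖ (γ((b, t]) ∪ K_b)` — the displayed
  sentence of Miller–Sheffield, via the radial Markov property `image_invCoord_compl_hull`;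
* `compl_hull_eq_unboundedComponent_mono` — the Markovian description from a base time `b` implies
  the one from any later base `T ∈ (b, t)`;
* `isCurve_of_disc_generated`, `isCurve_of_radial_curves` — **`C.IsCurve γ`** as soon as these
  hypotheses hold for all base times in a set unbounded below ("`S` can be taken arbitrarily
  small"), by `WholePlaneLoewnerChain.isCurve_of_forall_lt` (`WholePlaneSLEProofs`).

Everything is proved; no named fact is introduced. (The probabilistic input — a.s. the radial
pieces of whole-plane SLE_κ(ρ) are generated by continuous curves staying in `𝔻`, Miller–Sheffield
(2013), Prop. 2.3 and Lemma 2.4 — is not in this file.)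

## References

* J. Miller, S. Sheffield, *Imaginary geometry IV: interior rays, whole-plane reversibility, and
  space-filling trees*, PTRF 169 (2017), arXiv:1302.4738, §2.1.3, proof of Prop. 2.5.
  [MillerSheffield2013]
* G. F. Lawler, *Conformally Invariant Processes in the Plane*, AMS (2005), §4.3 Prop. 4.21, §6.6
  (`Hₜ` is the unbounded component of `ℂ ∖ γ[-∞, t]`). [Lawler2005]
-/

noncomputable section

open Set Filter Topology Complex Metric
open scoped NNReal

namespace Literature.Probability.RandomPlanarGeometry

namespace WholePlaneLoewnerChain

variable {lam : ℝ → ℝ}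

/-! ### Components and the unbounded component -/

/-- A connected unbounded set `Q ⊆ V` which is saturated for the components of `V` (every
component of `V` meeting `Q` lies in `Q`) with bounded complement is the union of the unbounded
components of `V`. [folklore] -/
theorem eq_unboundedComponent_of_saturated {Q V : Set ℂ} (hQV : Q ⊆ V) (hQ : IsPreconnected Q)
    (hQc : Bornology.IsBounded Qᶜ) (hQu : ¬ Bornology.IsBounded Q)
    (hsat : ∀ z ∈ Q, connectedComponentIn V z ⊆ Q) : Q = Loewner.unboundedComponent V := by
  ext z
  constructor
  · intro hz
    refine ⟨hQV hz, fun hbdd ↦ hQu (hbdd.subset ?_)⟩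
    exact hQ.subset_connectedComponentIn hz hQV
  · rintro ⟨hzV, hunb⟩
    obtain ⟨y, hyC, hyQ⟩ : ∃ y ∈ connectedComponentIn V z, y ∈ Q := by
      by_contra h
      push Not at h
      exact hunb (hQc.subset fun y hy ↦ h y hy)
    have hcc : connectedComponentIn V z = connectedComponentIn V y := connectedComponentIn_eq hyC
    exact hsat y hyQ (hcc ▸ mem_connectedComponentIn hzV)

/-- **Monotonicity of the Markovian description in the base time.** If `ℂ ∖ Kₜ` (connected,
unbounded, bounded complement) is the unbounded component of `ℂ ∖ A₀` and `A₀ ⊆ A ⊆ Kₜ`, then it is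
also the unbounded component of `ℂ ∖ A`. [folklore] -/
theorem compl_hull_eq_unboundedComponent_mono (C : WholePlaneLoewnerChain lam) {t : ℝ} {A₀ A : Set ℂ}
    (h₀ : (C.hull t)ᶜ = Loewner.unboundedComponent A₀ᶜ) (hA₀ : A₀ ⊆ A) (hA : A ⊆ C.hull t) :
    (C.hull t)ᶜ = Loewner.unboundedComponent Aᶜ := by
  refine eq_unboundedComponent_of_saturated (compl_subset_compl.2 hA)
    (C.isConnected_compl_hull t).isPreconnected (by simpa using C.isBounded_hull t)
    (C.not_isBounded_compl_hull t) fun z hz y hy ↦ ?_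
  -- the component of `y` in `Aᶜ` lies in its component in `A₀ᶜ`, which is unbounded
  have hzy : connectedComponentIn Aᶜ z = connectedComponentIn Aᶜ y := connectedComponentIn_eq hy
  have hyA : y ∈ Aᶜ := connectedComponentIn_subset _ _ hy
  rw [h₀]
  refine ⟨compl_subset_compl.2 hA₀ hyA, fun hbdd ↦ ?_⟩
  have hsub : connectedComponentIn Aᶜ y ⊆ connectedComponentIn A₀ᶜ y :=
    connectedComponentIn_mono y (compl_subset_compl.2 hA₀)
  have hQ : (C.hull t)ᶜ ⊆ connectedComponentIn Aᶜ y := by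
    rw [← hzy]
    exact (C.isConnected_compl_hull t).isPreconnected.subset_connectedComponentIn hz
      (compl_subset_compl.2 hA)
  exact C.not_isBounded_compl_hull t (hbdd.subset (hQ.trans hsub))

/-! ### The interior coordinate `Ψ_b = 1/g_b` and its inverse `w ↦ F_b(1/w)` -/

/-- `Ψ_b = 1/g_b` is continuous on `ℂ ∖ K_b`. [folklore] -/
theorem continuousOn_invCoord (C : WholePlaneLoewnerChain lam) (b : ℝ) :
    ContinuousOn (fun z ↦ (C.map b z)⁻¹) (C.hull b)ᶜ :=
  (C.continuousOn_map b).inv₀ fun _ hz ↦ C.map_ne_zero hz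

/-- `Ψ_b` is injective on `ℂ ∖ K_b`. [folklore] -/
theorem injOn_invCoord (C : WholePlaneLoewnerChain lam) (b : ℝ) :
    InjOn (fun z ↦ (C.map b z)⁻¹) (C.hull b)ᶜ := fun _ hz _ hz' h ↦
  (C.bijOn_map b).injOn hz hz' (inv_injective h)

/-- `F_b(1/Ψ_b(z)) = z` on `ℂ ∖ K_b`. [folklore] -/
theorem invMap_inv_invCoord (C : WholePlaneLoewnerChain lam) (hlam : Continuous lam) {b : ℝ} {z : ℂ}
    (hz : z ∉ C.hull b) : WholePlaneLoewner.BackwardFlow.invMap lam b ((C.map b z)⁻¹)⁻¹ = z := by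
  rw [inv_inv, C.invMap_map hlam hz]

/-- `Ψ_b` maps `ℂ ∖ K_b` into the punctured unit disc. [folklore] -/
theorem invCoord_mem (C : WholePlaneLoewnerChain lam) {b : ℝ} {z : ℂ} (hz : z ∉ C.hull b) :
    (C.map b z)⁻¹ ∈ ball (0 : ℂ) 1 \ {0} :=
  ⟨mem_ball_zero_iff.2 (C.norm_inv_map_lt_one hz), inv_ne_zero (C.map_ne_zero hz)⟩

/-! ### Radial generation implies the exterior Markovian description -/

/-- **From the radial curve in `𝔻` to the whole-plane hulls** (Miller–Sheffield (2013), proof of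
Prop. 2.5: "`Kₜ|_{[T,∞)}` is the complement of the unbounded connected component of
`ℂ ∖ ((1/g_T⁻¹)(η([T,t])) ∪ K_T)`"). Let `b < t`, let `γ` satisfy `γ(s) ∉ K_b` for `s ∈ (b, t]`
(the radial piece `η = 1/g_b ∘ γ` stays inside `𝔻`), and suppose the radial Loewner domain at time
`t - b` of the shifted driver `u ↦ -lam (b + u)` is the connected component of `0` in
`𝔻 ∖ η((b, t])`. Then `ℂ ∖ Kₜ` is the unbounded connected component of `ℂ ∖ (γ((b, t]) ∪ K_b)`.
Proof: by the radial Markov property (`image_invCoord_compl_hull`) `1/g_b` carries `ℂ ∖ Kₜ` onto that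
component minus `0`; a component of `ℂ ∖ (γ((b,t]) ∪ K_b)` meeting `ℂ ∖ Kₜ` is carried to a connected
subset of `𝔻 ∖ η((b,t])` meeting the component of `0`, hence into it, hence lies in `ℂ ∖ Kₜ`; and
`ℂ ∖ Kₜ` is connected and unbounded with bounded complement. [cite: MillerSheffield2013, Prop. 2.5] -/
theorem compl_hull_eq_unboundedComponent_of_disc (C : WholePlaneLoewnerChain lam) (hlam : Continuous lam)
    {γ : ℝ → ℂ} {b : ℝ} {u : ℝ≥0}
    (hN : ∀ s ∈ Ioc b (b + u), γ s ∉ C.hull b)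
    (hG : RadialLoewner.Disc.domain (WholePlaneLoewner.shiftDriver lam b) u =
      connectedComponentIn (ball (0 : ℂ) 1 \ (fun s ↦ (C.map b (γ s))⁻¹) '' Ioc b (b + u)) 0) :
    (C.hull (b + u))ᶜ = Loewner.unboundedComponent (γ '' Ioc b (b + u) ∪ C.hull b)ᶜ := by
  set Ψ : ℂ → ℂ := fun z ↦ (C.map b z)⁻¹ with hΨ
  set E : Set ℂ := (fun s ↦ (C.map b (γ s))⁻¹) '' Ioc b (b + u) with hE
  set V : Set ℂ := (γ '' Ioc b (b + u) ∪ C.hull b)ᶜ with hV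
  -- the interior image of `ℂ ∖ K_{b+u}` is the radial domain minus `0`
  have himg : Ψ '' (C.hull (b + u))ᶜ =
      RadialLoewner.Disc.domain (WholePlaneLoewner.shiftDriver lam b) u \ {0} :=
    C.image_invCoord_compl_hull hlam b u
  rw [hG] at himg
  -- points of the curve piece are swallowed by time `b + u`
  have hγK : ∀ s ∈ Ioc b (b + u), γ s ∈ C.hull (b + u) := by
    intro s hs
    by_contra hnot
    have h1 : Ψ (γ s) ∈ connectedComponentIn (ball (0 : ℂ) 1 \ E) 0 \ {0} :=
      himg ▸ mem_image_of_mem Ψ hnot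
    exact (connectedComponentIn_subset _ _ h1.1).2 ⟨s, hs, rfl⟩
  have hQV : (C.hull (b + u))ᶜ ⊆ V := by
    rw [hV, compl_subset_compl]
    rintro z (⟨s, hs, rfl⟩ | hz)
    · exact hγK s hs
    · exact C.hull_mono (by simp) hz
  refine eq_unboundedComponent_of_saturated hQV (C.isConnected_compl_hull _).isPreconnected
    (by simpa using C.isBounded_hull (b + u)) (C.not_isBounded_compl_hull _) fun z hz y hy ↦ ?_
  -- transport the component of `z` in `V` into the disc
  set P := connectedComponentIn V z with hP
  have hPV : P ⊆ V := connectedComponentIn_subset _ _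
  have hVb : V ⊆ (C.hull b)ᶜ := fun x hx hxb ↦ hx (Or.inr hxb)
  have hPb : P ⊆ (C.hull b)ᶜ := hPV.trans hVb
  have hPconn : IsPreconnected (Ψ '' P) :=
    isPreconnected_connectedComponentIn.image Ψ ((C.continuousOn_invCoord b).mono hPb)
  -- `Ψ(P) ⊆ 𝔻 ∖ E`
  have hPsub : Ψ '' P ⊆ ball (0 : ℂ) 1 \ E := by
    rintro _ ⟨x, hx, rfl⟩
    refine ⟨(C.invCoord_mem (hPb hx)).1, ?_⟩
    rintro ⟨s, hs, hsx⟩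
    have hxs : γ s = x := C.injOn_invCoord b (hN s hs) (hPb hx) hsx
    exact hPV hx (Or.inl ⟨s, hs, hxs⟩)
  -- `Ψ(P)` meets the component `D` of `0`, at `Ψ z`
  have hzP : z ∈ P := mem_connectedComponentIn (hQV hz)
  have hΨz : Ψ z ∈ connectedComponentIn (ball (0 : ℂ) 1 \ E) 0 := by
    have : Ψ z ∈ connectedComponentIn (ball (0 : ℂ) 1 \ E) 0 \ {0} := himg ▸ mem_image_of_mem Ψ hz
    exact this.1
  -- hence `Ψ(P) ⊆ D`
  have hPD : Ψ '' P ⊆ connectedComponentIn (ball (0 : ℂ) 1 \ E) 0 := by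
    rw [connectedComponentIn_eq hΨz]
    exact hPconn.subset_connectedComponentIn (mem_image_of_mem Ψ hzP) hPsub
  -- pull back: `Ψ y ∈ D ∖ {0} = Ψ(ℂ ∖ K_{b+u})`, and `Ψ` is injective off `K_b`
  have hΨy : Ψ y ∈ connectedComponentIn (ball (0 : ℂ) 1 \ E) 0 \ {0} :=
    ⟨hPD (mem_image_of_mem Ψ hy), (C.invCoord_mem (hPb hy)).2⟩
  rw [← himg] at hΨy
  obtain ⟨x, hx, hxy⟩ := hΨy
  have : x = y := C.injOn_invCoord b (fun h ↦ hx (C.hull_mono (by simp) h)) (hPb hy) hxy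
  exact this ▸ hx

/-- A point of the curve after the base time `b` lies in the hull at its own time, as soon as the
radial description holds at that time. [cite: MillerSheffield2013, Prop. 2.5] -/
theorem mem_hull_of_disc (C : WholePlaneLoewnerChain lam) (hlam : Continuous lam)
    {γ : ℝ → ℂ} {b : ℝ} {u : ℝ≥0} (hu : 0 < u)
    (hN : ∀ s ∈ Ioc b (b + u), γ s ∉ C.hull b)
    (hG : RadialLoewner.Disc.domain (WholePlaneLoewner.shiftDriver lam b) u =
      connectedComponentIn (ball (0 : ℂ) 1 \ (fun s ↦ (C.map b (γ s))⁻¹) '' Ioc b (b + u)) 0) :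
    γ (b + u) ∈ C.hull (b + u) := by
  by_contra hnot
  have h := C.compl_hull_eq_unboundedComponent_of_disc hlam hN hG
  have hmem : γ (b + u) ∈ Loewner.unboundedComponent (γ '' Ioc b (b + u) ∪ C.hull b)ᶜ := h ▸ hnot
  exact (Loewner.unboundedComponent_subset _ hmem) (Or.inl ⟨b + u, ⟨by simpa using hu, le_rfl⟩, rfl⟩)

/-! ### Assembly: `IsCurve` from the radial pieces at base times unbounded below -/

/-- **Whole-plane Loewner chains generated by curves, from the radial pieces** (deterministic
skeleton of Miller–Sheffield (2013), proof of Prop. 2.5, boundary-avoiding case). Let `γ : ℝ → ℂ`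
be continuous and let `S ⊆ ℝ` be unbounded below. Suppose that for every base time `b ∈ S`:
(non-hitting) `γ(s) ∉ K_b` for all `s > b`, and (radial generation) for every `u > 0` the radial
Loewner domain at time `u` of the shifted driver `v ↦ -lam (b + v)` is the connected component of
`0` in `𝔻 ∖ (1/g_b ∘ γ)((b, b + u])`. Then `C` is generated by `γ`: `γ` is continuous, `γ(t) → 0` as
`t → -∞`, and `ℂ ∖ Kₜ` is the unbounded component of `ℂ ∖ ({0} ∪ γ((-∞, t]))` for every `t`
("The result follows since `S` can be taken arbitrarily small"). [cite: MillerSheffield2013, Prop. 2.5] -/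
theorem isCurve_of_disc_generated (C : WholePlaneLoewnerChain lam) (hlam : Continuous lam)
    {γ : ℝ → ℂ} (hγ : Continuous γ) {S : Set ℝ} (hS : ∀ t : ℝ, ∃ b ∈ S, b < t)
    (hN : ∀ b ∈ S, ∀ s : ℝ, b < s → γ s ∉ C.hull b)
    (hG : ∀ b ∈ S, ∀ u : ℝ≥0, 0 < u →
      RadialLoewner.Disc.domain (WholePlaneLoewner.shiftDriver lam b) u =
        connectedComponentIn (ball (0 : ℂ) 1 \ (fun s ↦ (C.map b (γ s))⁻¹) '' Ioc b (b + u)) 0) :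
    C.IsCurve γ := by
  -- the Markovian description from every base time in `S`
  have hgenS : ∀ b ∈ S, ∀ t : ℝ, b < t →
      (C.hull t)ᶜ = Loewner.unboundedComponent (γ '' Ioc b t ∪ C.hull b)ᶜ := by
    intro b hb t hbt
    set u : ℝ≥0 := ⟨t - b, by linarith⟩ with hu
    have hupos : 0 < u := by rw [← NNReal.coe_pos]; change 0 < t - b; linarith
    have ht : b + u = t := by change b + (t - b) = t; ring
    rw [← ht]
    exact C.compl_hull_eq_unboundedComponent_of_disc hlam
      (fun s hs ↦ hN b hb s hs.1) (hG b hb u hupos)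
  -- every point of the curve lies in the hull of its time
  have hγK : ∀ s : ℝ, γ s ∈ C.hull s := by
    intro s
    obtain ⟨b, hb, hbs⟩ := hS s
    by_contra hnot
    have hmem : γ s ∈ Loewner.unboundedComponent (γ '' Ioc b s ∪ C.hull b)ᶜ := hgenS b hb s hbs ▸ hnot
    exact (Loewner.unboundedComponent_subset _ hmem) (Or.inl ⟨s, ⟨hbs, le_rfl⟩, rfl⟩)
  -- hence `γ(t) → 0` as `t → -∞`
  have h0 : Tendsto γ atBot (𝓝 0) := by
    refine tendsto_nhds.2 fun U hU h0U ↦ ?_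
    obtain ⟨T₀, hT₀⟩ := (C.eventually_hull_subset (hU.mem_nhds h0U)).exists_forall_of_atBot
    exact eventually_atBot.2 ⟨T₀, fun s hs ↦ hT₀ s hs (hγK s)⟩
  -- the Markovian description from every base time, and `isCurve_of_forall_lt`
  refine C.isCurve_of_forall_lt hγ h0 fun T t hTt ↦ ?_
  obtain ⟨b, hb, hbT⟩ := hS T
  refine C.compl_hull_eq_unboundedComponent_mono (hgenS b hb t (hbT.trans hTt)) ?_ ?_
  · rintro z (⟨s, hs, rfl⟩ | hz)
    · rcases le_or_gt T s with hTs | hsT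
      · exact Or.inl ⟨s, ⟨hTs, hs.2⟩, rfl⟩
      · exact Or.inr (C.hull_mono hsT.le (hγK s))
    · exact Or.inr (C.hull_mono hbT.le hz)
  · rintro z (⟨s, hs, rfl⟩ | hz)
    · exact C.hull_mono hs.2 (hγK s)
    · exact C.hull_mono hTt.le hz

/-- **The same, with the radial curves given on `[0, ∞)`** in the form produced by the theory of
radial Loewner chains: for each base time `b ∈ S` a curve `η_b : ℝ≥0 → ℂ` starting on the unit
circle (`1 ≤ |η_b 0|`, the driving point), equal to `1/g_b(γ(b + u))` for `u > 0`, such that the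
radial Loewner domain at time `u` is the component of `0` in `𝔻 ∖ η_b([0, u])` (Lawler (2005),
§6.5: "`D_t` is the connected component of `𝔻 ∖ γ[0,t]` containing the origin"), with `γ(s) ∉ K_b`
for `s > b`. Then `C.IsCurve γ`. [cite: MillerSheffield2013, Prop. 2.5] -/
theorem isCurve_of_radial_curves (C : WholePlaneLoewnerChain lam) (hlam : Continuous lam)
    {γ : ℝ → ℂ} (hγ : Continuous γ) {S : Set ℝ} (hS : ∀ t : ℝ, ∃ b ∈ S, b < t)
    (hN : ∀ b ∈ S, ∀ s : ℝ, b < s → γ s ∉ C.hull b)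
    (η : ℝ → ℝ≥0 → ℂ) (hη0 : ∀ b ∈ S, 1 ≤ ‖η b 0‖)
    (hηγ : ∀ b ∈ S, ∀ u : ℝ≥0, 0 < u → η b u = (C.map b (γ (b + u)))⁻¹)
    (hG : ∀ b ∈ S, ∀ u : ℝ≥0,
      RadialLoewner.Disc.domain (WholePlaneLoewner.shiftDriver lam b) u =
        connectedComponentIn (ball (0 : ℂ) 1 \ η b '' Icc 0 u) 0) :
    C.IsCurve γ := by
  refine C.isCurve_of_disc_generated hlam hγ hS hN fun b hb u hu ↦ ?_
  rw [hG b hb u]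
  congr 1
  -- `𝔻 ∖ η_b([0,u]) = 𝔻 ∖ (1/g_b ∘ γ)((b, b+u])` since `η_b 0 ∉ 𝔻`
  ext w
  simp only [Set.mem_sdiff, mem_image, mem_Icc, mem_Ioc, and_congr_right_iff]
  intro hw
  refine not_congr ⟨?_, ?_⟩
  · rintro ⟨v, ⟨hv0, hvu⟩, rfl⟩
    rcases hv0.eq_or_lt with rfl | hvpos
    · exact absurd (mem_ball_zero_iff.1 hw) (not_lt.2 (hη0 b hb))
    · exact ⟨b + v, ⟨by simpa using hvpos, by simpa using hvu⟩, (hηγ b hb v hvpos).symm⟩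
  · rintro ⟨s, ⟨hbs, hsu⟩, hsw⟩
    obtain ⟨v, hv⟩ : ∃ v : ℝ≥0, (v : ℝ) = s - b := ⟨⟨s - b, by linarith⟩, rfl⟩
    have hpos : (0 : ℝ≥0) < v := by rw [← NNReal.coe_pos, hv]; linarith
    have hle : v ≤ u := by rw [← NNReal.coe_le_coe, hv]; linarith
    have hbs' : b + (v : ℝ) = s := by rw [hv]; ring
    refine ⟨v, ⟨bot_le, hle⟩, ?_⟩
    rw [hηγ b hb v hpos, hbs']
    exact hsw

end WholePlaneLoewnerChain

end Literature.Probability.RandomPlanarGeometry
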